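import Mathlib

/-!
# Crux `PicoverLocalModel` (stmt-ResolutionOfSingularities-0557), line `SketchIdeator3`
# (giraud-cossart-normal-form) — the DVR dichotomy (Giraud's normal form in codimension one)

Registered helper of the line: in a discrete valuation ring `O` of characteristic `p` with
uniformizer `ϖ`, if the Frobenius class of `a` is `ϖ`-adically separated from the `p`-th powers
(`∃ N, ∀ b, ¬ ϖ ^ N ∣ a - b ^ p`), then some representative of the class `a + O^p` has the shape
`a - b ^ p = ϖ ^ m * u` with `u` a unit and EITHER `p ∤ m` (Kummer/toric exit) OR the residue of
`u` is not a `p`-th power, i.e. `∀ c, ¬ ϖ ∣ u - c ^ p` (wound exit).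

Proof: every `a - b ^ p` is nonzero, hence `ϖ ^ n * unit` with `n < N`; take `m` maximal among
the exponents so obtained (`Nat.findGreatest`). If `m = p * q` and `ϖ ∣ u - c ^ p`, then
`b' := b + ϖ ^ q * c` has `a - b' ^ p = ϖ ^ m * (u - c ^ p)` (freshman's dream), which is
divisible by `ϖ ^ (m + 1)`, contradicting the maximality of `m`.
-/

-- The namespace mirrors the crux/line layout (`…Theorems.PicoverLocalModel.DvrDichotomy`) on purpose.
set_option linter.dupNamespace false
-- The registered signature carries both `[IsDomain O]` and `[IsDiscreteValuationRing O]` (verbatim).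
set_option linter.overlappingInstances false

namespace Summit.ResolutionOfSingularities.ResolutionOfSingularities.Theorems.PicoverLocalModel.DvrDichotomy

/-- **DVR dichotomy** (Giraud's normal form is free in codimension one): in a DVR `O` of
characteristic `p` with uniformizer `ϖ`, if `∃ N, ∀ b, ¬ ϖ ^ N ∣ a - b ^ p`, then
`a - b ^ p = ϖ ^ m * u` for some `b`, some unit `u` and some `m` with `¬ p ∣ m` or
`∀ c, ¬ ϖ ∣ u - c ^ p`. [folklore] -/
theorem exists_sub_pow_eq_mul_unit_dichotomy : ∀ {O : Type*} [CommRing O] [IsDomain O] [IsDiscreteValuationRing O] (p : ℕ) [CharP O p], p.Prime → ∀ (ϖ : O), Irreducible ϖ → ∀ (a : O), (∃ N : ℕ, ∀ b : O, ¬ ϖ ^ N ∣ a - b ^ p) → ∃ (b : O) (m : ℕ) (u : Oˣ), a - b ^ p = ϖ ^ m * (u : O) ∧ (¬ p ∣ m ∨ ∀ c : O, ¬ ϖ ∣ (u : O) - c ^ p) := by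
  intro O _ _ _ p _ hp ϖ hϖ a hN
  obtain ⟨N, hN⟩ := hN
  classical
  -- every `a - b ^ p` is `ϖ ^ n * unit` with `n < N`
  have key : ∀ b : O, ∃ (n : ℕ) (u : Oˣ), a - b ^ p = ϖ ^ n * (u : O) ∧ n < N := by
    intro b
    have hne : a - b ^ p ≠ 0 := fun h => hN b (h ▸ dvd_zero _)
    obtain ⟨n, u, hnu⟩ := IsDiscreteValuationRing.eq_unit_mul_pow_irreducible hne hϖ
    refine ⟨n, u, by rw [hnu, mul_comm], ?_⟩
    by_contra hle
    push Not at hle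
    exact hN b (hnu ▸ dvd_mul_of_dvd_right (pow_dvd_pow ϖ hle) _)
  set P : ℕ → Prop := fun m => ∃ (b : O) (u : Oˣ), a - b ^ p = ϖ ^ m * (u : O) with hP
  have hPm : P (Nat.findGreatest P N) := by
    obtain ⟨n, u, hnu, hn⟩ := key 0
    exact Nat.findGreatest_spec (P := P) hn.le ⟨0, u, hnu⟩
  obtain ⟨b, u, hbu⟩ := hPm
  refine ⟨b, Nat.findGreatest P N, u, hbu, ?_⟩
  by_contra hcon
  push Not at hcon
  obtain ⟨⟨q, hq⟩, c, w, hw⟩ := hcon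
  haveI : Fact p.Prime := ⟨hp⟩
  -- the corrected representative `b + ϖ ^ q * c` gains one order of `ϖ`
  have hb' : a - (b + ϖ ^ q * c) ^ p = ϖ ^ (Nat.findGreatest P N + 1) * w := by
    rw [add_pow_char, mul_pow, ← pow_mul, mul_comm q p, ← hq, pow_succ]
    have ha : a = ϖ ^ Nat.findGreatest P N * (u : O) + b ^ p := by rw [← hbu]; ring
    have hu : (u : O) = ϖ * w + c ^ p := by rw [← hw]; ring
    rw [ha, hu]; ring
  obtain ⟨n', u', hn'u', hn'⟩ := key (b + ϖ ^ q * c)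
  have hlt : Nat.findGreatest P N < n' := by
    have h1 : ϖ ^ (Nat.findGreatest P N + 1) ∣ ϖ ^ n' * (u' : O) := by
      rw [← hn'u', hb']; exact dvd_mul_right _ _
    have h2 := (pow_dvd_pow_iff hϖ.ne_zero hϖ.not_isUnit).mp (Units.dvd_mul_right.mp h1)
    omega
  exact Nat.findGreatest_is_greatest hlt hn'.le ⟨_, u', hn'u'⟩

end Summit.ResolutionOfSingularities.ResolutionOfSingularities.Theorems.PicoverLocalModel.DvrDichotomy
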